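import Summits.AtomisticToContinuum.BoseEinsteinCondensation.Theses.BECInsertionCorrector
import Summits.AtomisticToContinuum.BoseEinsteinCondensation.Theses.BECBathMassLiouville
import Literature.MathematicalPhysics.QuantumManyBody.PeriodicBoseGasFourier
import Summits.AtomisticToContinuum.BoseEinsteinCondensation.Theorems.CorrectorClosure.Negative.InsertionResidueLoadBearing

/-!
# Negative lemmas for crux `StaticResponseBound` (stmt-AtomisticToContinuum-12057) — I: the
# statement unbundled, `k ≠ 0` load-bearing, certified trivial regimes

Supports (does not close) stmt-AtomisticToContinuum-12057 (routes `BECInsertionCorrector` rank 2,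
`BECBathMassLiouville` rank 3); importable form of the cdisprove seat's standing file
`Cruxes/StaticResponseBound/Disproof.lean` (generation 2), part I:

* §A `Body`, `Ineq`, `cosMean`, `psq`; `staticResponseBound_iff` (`Iff.rfl`),
  `staticResponseBound_routes_agree`, the discriminant/susceptibility form
  `forall_ineq_iff_discriminant` (`⟨∑cos⟩_Ψ² ≤ 4CN(E_Ψ−E₀)/max(ρa,|p|²)` for all finite-energy `Ψ`),
  monotonicity in `C`, `ρ₀` (`staticResponseBound_iff_large_C`: WLOG `C ≥ 1`);
* §B `not_staticResponseBoundAnyK` — deleting `k ≠ 0` makes the crux false (`v = 0`, `N = 1`);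
* §G `integral_norm_sq_eq_one`, `abs_cosMean_le` (`|⟨∑cos⟩_Ψ| ≤ N`), `ineq_zero`, `ineq_N_zero`,
  `ineq_of_large_t` — the inner inequality at `t = 0`, `N = 0`, `|t| ≥ max(ρa,|p|²)/C` is free; the
  open remainder of the crux is the window `0 < |t| < max/C` for interacting `N ≥ 1`.
-/

namespace Summit.AtomisticToContinuum.BoseEinsteinCondensation.Theorems.StaticResponseBound.Negative

open MeasureTheory
open scoped ENNReal
open Literature.MathematicalPhysics.QuantumManyBody.BoseGas
open Summit.AtomisticToContinuum.BoseEinsteinCondensation.Theses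
open Summit.AtomisticToContinuum.BoseEinsteinCondensation.Theorems.CorrectorClosure.Negative (e0 e0_ne_zero)

noncomputable section

/-! ## §A  The crux unbundled: body, inner inequality, discriminant form -/

/-- `|p|² = (2π/L)² ∑ᵢ kᵢ²`, the crux's second `max` argument. [folklore] -/
def psq (L : ℝ) (k : Fin 3 → ℤ) : ℝ :=
  (2 * Real.pi / L) ^ 2 * ∑ i, (k i : ℝ) ^ 2

/-- `⟨∑ⱼ cos(p·xⱼ)⟩_Ψ = ∫_{cell^N} (∑ⱼ cos(2π k·xⱼ/L)) |Ψ|²` — verbatim the crux's integral. [folklore] -/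
def cosMean {N : ℕ} (L : ℝ) (k : Fin 3 → ℤ) (Ψ : PeriodicTrialState N L) : ℝ :=
  ∫ X in cellN N L, (∑ j, Real.cos (2 * Real.pi / L * ∑ i, (k i : ℝ) * X j i)) * ‖Ψ.ψ X‖ ^ 2

/-- The crux's inner inequality at data `(v, C, ρ, N, k, t, Ψ)`. [folklore] -/
def Ineq (v : ℝ → ℝ≥0∞) (C ρ : ℝ) (N : ℕ) (k : Fin 3 → ℤ) (t : ℝ)
    (Ψ : PeriodicTrialState N (sideLength ρ N)) : Prop :=
  (periodicGroundStateEnergy v N (sideLength ρ N)).toReal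
      - C * t ^ 2 * N / max (ρ * (scatteringLength v).toReal) (psq (sideLength ρ N) k)
    ≤ (periodicEnergy v Ψ).toReal + t * cosMean (sideLength ρ N) k Ψ

/-- The crux's body at fixed potential and constants `(ρ₀, C)`. -/
def Body (v : ℝ → ℝ≥0∞) (ρ₀ C : ℝ) : Prop :=
  ∀ ρ : ℝ, 0 < ρ → ρ < ρ₀ → ∀ N : ℕ, ∀ k : Fin 3 → ℤ, k ≠ 0 → ∀ t : ℝ,
    ∀ Ψ : PeriodicTrialState N (sideLength ρ N), periodicEnergy v Ψ ≠ ⊤ → Ineq v C ρ N k t Ψ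

/-- The crux is literally `∀ v, IsRepulsiveFiniteRange v → ∃ ρ₀ > 0, ∃ C > 0, Body v ρ₀ C`. [folklore] -/
theorem staticResponseBound_iff :
    BECInsertionCorrector.StaticResponseBound ↔
      ∀ v : ℝ → ℝ≥0∞, IsRepulsiveFiniteRange v → ∃ ρ₀ : ℝ, 0 < ρ₀ ∧ ∃ C : ℝ, 0 < C ∧ Body v ρ₀ C :=
  Iff.rfl

/-- The two routes wanting the item (BECInsertionCorrector rank 2, BECBathMassLiouville rank 3)
state it verbatim identically: one refutation / proof serves both. [folklore] -/
theorem staticResponseBound_routes_agree :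
    BECInsertionCorrector.StaticResponseBound ↔ BECBathMassLiouville.StaticResponseBound :=
  Iff.rfl

/-- Elementary discriminant: `∀ t, A - B t² ≤ E + t X` iff `X² ≤ 4 B (E - A)` (for `B > 0`). [folklore] -/
theorem forall_quad_iff {A E X B : ℝ} (hB : 0 < B) :
    (∀ t : ℝ, A - B * t ^ 2 ≤ E + t * X) ↔ X ^ 2 ≤ 4 * B * (E - A) := by
  constructor
  · intro h
    set s := X / (2 * B) with hs
    have hX : X = 2 * B * s := by rw [hs]; field_simp
    have h1 := h (-s)
    rw [hX] at h1 ⊢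
    nlinarith [h1, hB, sq_nonneg s]
  · intro h t
    nlinarith [sq_nonneg (2 * B * t + X), hB]

/-- With `B = 0` the family of inequalities degenerates to `X = 0 ∧ A ≤ E`. [folklore] -/
theorem forall_quad_zero_iff {A E X : ℝ} :
    (∀ t : ℝ, A - 0 * t ^ 2 ≤ E + t * X) ↔ X = 0 ∧ A ≤ E := by
  constructor
  · intro h
    have h0 := h 0
    simp only [zero_mul, sub_zero, add_zero] at h0
    refine ⟨?_, h0⟩
    by_contra hX
    rcases lt_or_gt_of_ne hX with hlt | hgt
    · have := h ((E - A + 1) / (-X))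
      have hX' : 0 < -X := by linarith
      rw [zero_mul, sub_zero, div_mul_eq_mul_div, mul_comm, ← div_mul_eq_mul_div,
        div_neg, div_self hX, neg_mul, one_mul] at this
      · linarith
    · have := h (-((E - A + 1) / X))
      rw [zero_mul, sub_zero, neg_mul, div_mul_cancel₀ _ hgt.ne'] at this
      linarith
  · rintro ⟨rfl, hAE⟩ t
    simpa using hAE

/-- DISCRIMINANT (susceptibility) FORM of the inner inequality: for `N ≥ 1`, `C > 0` and a
non-degenerate denominator, `(∀ t, Ineq)` says exactly
`⟨∑cos⟩_Ψ² ≤ 4 C N (E_Ψ - E₀) / max(ρa, p²)` — a bound `χ_N(p) ≤ 2CN/max(ρa,p²)` on the static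
density response, to hold for EVERY finite-energy state, not only perturbatively. [folklore] -/
theorem forall_ineq_iff_discriminant (v : ℝ → ℝ≥0∞) {C ρ : ℝ} {N : ℕ} (k : Fin 3 → ℤ)
    (Ψ : PeriodicTrialState N (sideLength ρ N)) (hC : 0 < C) (hN : 0 < N)
    (hmax : 0 < max (ρ * (scatteringLength v).toReal) (psq (sideLength ρ N) k)) :
    (∀ t : ℝ, Ineq v C ρ N k t Ψ) ↔
      cosMean (sideLength ρ N) k Ψ ^ 2 ≤
        4 * (C * N / max (ρ * (scatteringLength v).toReal) (psq (sideLength ρ N) k)) *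
          ((periodicEnergy v Ψ).toReal
            - (periodicGroundStateEnergy v N (sideLength ρ N)).toReal) := by
  have hB : 0 < C * N / max (ρ * (scatteringLength v).toReal) (psq (sideLength ρ N) k) := by
    have : (0 : ℝ) < N := by exact_mod_cast hN
    positivity
  rw [← forall_quad_iff hB]
  unfold Ineq
  constructor <;> intro h t <;> have := h t
  · calc _ = (periodicGroundStateEnergy v N (sideLength ρ N)).toReal - C * t ^ 2 * ↑N /
          max (ρ * (scatteringLength v).toReal) (psq (sideLength ρ N) k) := by ring
      _ ≤ _ := this
  · calc _ = (periodicGroundStateEnergy v N (sideLength ρ N)).toReal -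
          C * ↑N / max (ρ * (scatteringLength v).toReal) (psq (sideLength ρ N) k) * t ^ 2 := by ring
      _ ≤ _ := this

/-- Monotonicity in the constant: a larger `C` only weakens the body. [folklore] -/
theorem Body.mono_C {v : ℝ → ℝ≥0∞} {ρ₀ C C' : ℝ} (h : Body v ρ₀ C) (hCC' : C ≤ C') :
    Body v ρ₀ C' := by
  intro ρ hρ hρ₀ N k hk t Ψ hΨ
  have h1 := h ρ hρ hρ₀ N k hk t Ψ hΨ
  unfold Ineq at h1 ⊢
  have hmax : 0 ≤ max (ρ * (scatteringLength v).toReal) (psq (sideLength ρ N) k) :=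
    le_max_of_le_right (by unfold psq; positivity)
  have : C * t ^ 2 * N / max (ρ * (scatteringLength v).toReal) (psq (sideLength ρ N) k) ≤
      C' * t ^ 2 * N / max (ρ * (scatteringLength v).toReal) (psq (sideLength ρ N) k) := by
    apply div_le_div_of_nonneg_right _ hmax
    have : (0 : ℝ) ≤ t ^ 2 * N := by positivity
    nlinarith
  linarith

/-- Monotonicity in the density threshold: a smaller `ρ₀` only weakens the body. [folklore] -/
theorem Body.mono_ρ₀ {v : ℝ → ℝ≥0∞} {ρ₀ ρ₀' C : ℝ} (h : Body v ρ₀ C) (hle : ρ₀' ≤ ρ₀) :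
    Body v ρ₀' C :=
  fun ρ hρ hρ₀ => h ρ hρ (hρ₀.trans_le hle)

/-- Hence the crux may equivalently be asked with `C ≥ 1` (or any fixed floor) — only the
EXISTENCE of a finite constant matters, and §C below shows none below `1/2` can work. [folklore] -/
theorem staticResponseBound_iff_large_C :
    BECInsertionCorrector.StaticResponseBound ↔
      ∀ v : ℝ → ℝ≥0∞, IsRepulsiveFiniteRange v → ∃ ρ₀ : ℝ, 0 < ρ₀ ∧ ∃ C : ℝ, 1 ≤ C ∧ Body v ρ₀ C := by
  rw [staticResponseBound_iff]
  refine forall₂_congr fun v _ => ⟨?_, ?_⟩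
  · rintro ⟨ρ₀, hρ₀, C, hC, hB⟩
    exact ⟨ρ₀, hρ₀, max C 1, le_max_right _ _, hB.mono_C (le_max_left _ _)⟩
  · rintro ⟨ρ₀, hρ₀, C, hC, hB⟩
    exact ⟨ρ₀, hρ₀, C, by linarith, hB⟩

/-- `|p|²` at `k = e₀` is `(2π/L)²`. [folklore] -/
theorem psq_e0 (L : ℝ) : psq L e0 = (2 * Real.pi / L) ^ 2 := by
  unfold psq e0
  simp [Fin.sum_univ_three]

/-- `|p|² ≥ 0`. [folklore] -/
theorem psq_nonneg (L : ℝ) (k : Fin 3 → ℤ) : 0 ≤ psq L k := by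
  unfold psq; positivity

/-- `|p|² > 0` at `k = e₀` for `L > 0`. [folklore] -/
theorem psq_e0_pos {L : ℝ} (hL : 0 < L) : 0 < psq L e0 := by
  rw [psq_e0]; positivity

/-! ## §B  The hypothesis `k ≠ 0` is load-bearing

Deleting `k ≠ 0` makes the statement false already for the free gas and one particle: at
`k = 0` the perturbation is the constant `N`, its first-order shift `tN` is not cancelled, and
the denominator `max(ρa, |p|²) = max(0, 0) = 0` is Lean-junk (`x / 0 = 0`). -/

/-- The crux with the hypothesis `k ≠ 0` deleted (everything else verbatim). -/
def StaticResponseBoundAnyK : Prop :=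
  ∀ v : ℝ → ℝ≥0∞, IsRepulsiveFiniteRange v → ∃ ρ₀ : ℝ, 0 < ρ₀ ∧ ∃ C : ℝ, 0 < C ∧
    ∀ ρ : ℝ, 0 < ρ → ρ < ρ₀ → ∀ N : ℕ, ∀ k : Fin 3 → ℤ, ∀ t : ℝ,
      ∀ Ψ : PeriodicTrialState N (sideLength ρ N), periodicEnergy v Ψ ≠ ⊤ → Ineq v C ρ N k t Ψ

/-- The free gas is an admissible interaction. [folklore] -/
theorem isRepulsiveFiniteRange_zero : IsRepulsiveFiniteRange (0 : ℝ → ℝ≥0∞) :=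
  ⟨measurable_const, 0, fun _ _ => rfl⟩

/-- `L = (N/ρ)^{1/3} > 0` for `N ≥ 1`, `ρ > 0`. [folklore] -/
theorem sideLength_pos {ρ : ℝ} (hρ : 0 < ρ) {N : ℕ} (hN : 0 < N) : 0 < sideLength ρ N := by
  unfold sideLength
  apply Real.rpow_pos_of_pos
  have : (0 : ℝ) < N := by exact_mod_cast hN
  positivity

/-- The constant one-particle state has zero energy, whatever `v`. [folklore] -/
theorem periodicEnergy_const {L : ℝ} (hL : 0 < L) (v : ℝ → ℝ≥0∞) :
    periodicEnergy v (PeriodicTrialState.const hL) = 0 := by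
  refine (lintegral_congr fun X => ?_).trans lintegral_zero
  simp [PeriodicTrialState.const, kineticDensity, periodicInteraction]

/-- At `k = 0` the "density wave" is the particle number: `⟨∑ⱼ cos 0⟩ = N = 1`. [folklore] -/
theorem cosMean_zero_const {L : ℝ} (hL : 0 < L) :
    cosMean L 0 (PeriodicTrialState.const hL) = 1 := by
  unfold cosMean
  have h3 : 0 < L ^ 3 := by positivity
  have hc : ∀ X : Config 1,
      (∑ j : Fin 1, Real.cos (2 * Real.pi / L * ∑ i : Fin 3, ((0 : Fin 3 → ℤ) i : ℝ) * X j i)) *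
        ‖(PeriodicTrialState.const hL).ψ X‖ ^ 2 = (L ^ 3)⁻¹ := by
    intro X
    simp [PeriodicTrialState.const, Real.sq_sqrt h3.le]
  simp_rw [hc]
  rw [setIntegral_const, measureReal_def, volume_cellN, pow_one, ← ENNReal.ofReal_pow hL.le,
    ENNReal.toReal_ofReal h3.le, smul_eq_mul, mul_inv_cancel₀ h3.ne']

/-- **`k ≠ 0` is load-bearing**: witness `v = 0`, `ρ = ρ₀/2`, `N = 1`, `k = 0`, `t = -1`,
`Ψ ≡ L^{-3/2}`; the inner inequality reads `0 - 0 ≤ 0 - 1`. Any proof of the crux must use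
`k ≠ 0` (it is what kills the first-order term `t⟨∑cos⟩ = tN·δ_{k,0}`). [folklore] -/
theorem not_staticResponseBoundAnyK : ¬ StaticResponseBoundAnyK := by
  intro h
  obtain ⟨ρ₀, hρ₀, C, _hC, hB⟩ := h 0 isRepulsiveFiniteRange_zero
  have hρ : (0 : ℝ) < ρ₀ / 2 := by positivity
  have hL : 0 < sideLength (ρ₀ / 2) 1 := sideLength_pos hρ one_pos
  have key := hB (ρ₀ / 2) hρ (by linarith) 1 0 (-1) (PeriodicTrialState.const hL)
    (by rw [periodicEnergy_const]; exact ENNReal.zero_ne_top)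
  unfold Ineq at key
  rw [periodicGroundStateEnergy_one hL, periodicEnergy_const, cosMean_zero_const,
    scatteringLength_zero] at key
  norm_num [psq] at key

/-! ## §G  Certified trivial regimes: `t = 0` and `|t| ≥ max(ρa,|p|²)/C`

What is NOT open: the inner inequality at `t = 0` (variational principle) and for
`|t| ≥ max(ρa,|p|²)/C` (the trivial floor `⟨H + t∑cos⟩ ≥ E₀ − |t|N`).  Together with the free
completed square (`|t| ≥ |p|√(E₀/((C−1)N))` on the branch `max = |p|²`, generation 1 / sibling
`srbAt_zero`) this pins the OPEN REMAINDER of the crux to the window `|t| < max(ρa,|p|²)/C` with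
`N ≥ 2` interacting particles: the genuine second-order (and non-perturbative) density response. -/

/-- The Bochner normalisation of an admissible state: `∫_{cell^N} |Ψ|² = 1`. [folklore] -/
theorem integral_norm_sq_eq_one {N : ℕ} {L : ℝ} (Ψ : PeriodicTrialState N L) :
    ∫ X in cellN N L, ‖Ψ.ψ X‖ ^ 2 = 1 := by
  have hint : Integrable (fun X => ‖Ψ.ψ X‖ ^ 2) (volume.restrict (cellN N L)) :=
    integrableOn_cellN ((Ψ.contDiff.continuous.norm).pow 2) L
  have h := ofReal_integral_eq_lintegral_ofReal hint
    (Filter.Eventually.of_forall fun X => sq_nonneg _)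
  simp_rw [← coe_nnnorm_sq_eq_ofReal] at h
  rw [Ψ.norm_eq] at h
  have hnn : 0 ≤ ∫ X in cellN N L, ‖Ψ.ψ X‖ ^ 2 := integral_nonneg fun X => sq_nonneg _
  have := congrArg ENNReal.toReal h
  rwa [ENNReal.toReal_ofReal hnn, ENNReal.toReal_one] at this

/-- `|⟨∑ⱼ cos(p·xⱼ)⟩_Ψ| ≤ N`. [folklore] -/
theorem abs_cosMean_le {N : ℕ} {L : ℝ} (k : Fin 3 → ℤ) (Ψ : PeriodicTrialState N L) :
    |cosMean L k Ψ| ≤ N := by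
  unfold cosMean
  have hcont : Continuous fun X : Config N =>
      (∑ j, Real.cos (2 * Real.pi / L * ∑ i, (k i : ℝ) * X j i)) * ‖Ψ.ψ X‖ ^ 2 := by
    have := Ψ.contDiff.continuous
    fun_prop
  have hpt : ∀ X : Config N,
      |(∑ j, Real.cos (2 * Real.pi / L * ∑ i, (k i : ℝ) * X j i)) * ‖Ψ.ψ X‖ ^ 2| ≤
        N * ‖Ψ.ψ X‖ ^ 2 := by
    intro X
    rw [abs_mul, abs_of_nonneg (sq_nonneg ‖Ψ.ψ X‖)]
    refine mul_le_mul_of_nonneg_right ?_ (sq_nonneg _)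
    calc |∑ j, Real.cos (2 * Real.pi / L * ∑ i, (k i : ℝ) * X j i)|
        ≤ ∑ j, |Real.cos (2 * Real.pi / L * ∑ i, (k i : ℝ) * X j i)| := Finset.abs_sum_le_sum_abs _ _
      _ ≤ ∑ _j : Fin N, (1 : ℝ) := Finset.sum_le_sum fun j _ => Real.abs_cos_le_one _
      _ = N := by simp
  have hint2 : Integrable (fun X => (N : ℝ) * ‖Ψ.ψ X‖ ^ 2) (volume.restrict (cellN N L)) :=
    (integrableOn_cellN ((Ψ.contDiff.continuous.norm).pow 2) L).const_mul _
  calc |∫ X in cellN N L, (∑ j, Real.cos (2 * Real.pi / L * ∑ i, (k i : ℝ) * X j i)) * ‖Ψ.ψ X‖ ^ 2|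
      ≤ ∫ X in cellN N L, |(∑ j, Real.cos (2 * Real.pi / L * ∑ i, (k i : ℝ) * X j i)) * ‖Ψ.ψ X‖ ^ 2| :=
        abs_integral_le_integral_abs
    _ ≤ ∫ X in cellN N L, (N : ℝ) * ‖Ψ.ψ X‖ ^ 2 :=
        integral_mono_of_nonneg (Filter.Eventually.of_forall fun X => abs_nonneg _) hint2
          (Filter.Eventually.of_forall hpt)
    _ = N := by rw [integral_const_mul, integral_norm_sq_eq_one, mul_one]

/-- **`t = 0`**: the inner inequality is the variational principle. [folklore] -/
theorem ineq_zero (v : ℝ → ℝ≥0∞) (C ρ : ℝ) {N : ℕ} (k : Fin 3 → ℤ)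
    (Ψ : PeriodicTrialState N (sideLength ρ N)) (hΨ : periodicEnergy v Ψ ≠ ⊤) :
    Ineq v C ρ N k 0 Ψ := by
  unfold Ineq
  have hE := ENNReal.toReal_mono hΨ (periodicGroundStateEnergy_le v Ψ)
  simpa using hE

/-- **`N = 0`**: no particles, no density wave (`∑ over Fin 0 = 0`); the inequality is
`E₀ ≤ E_Ψ` again (here `sideLength ρ 0 = 0` and `cellN 0 0 = univ`, harmless junk). [folklore] -/
theorem ineq_N_zero (v : ℝ → ℝ≥0∞) (C ρ : ℝ) (k : Fin 3 → ℤ) (t : ℝ)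
    (Ψ : PeriodicTrialState 0 (sideLength ρ 0)) (hΨ : periodicEnergy v Ψ ≠ ⊤) :
    Ineq v C ρ 0 k t Ψ := by
  unfold Ineq cosMean
  have hE := ENNReal.toReal_mono hΨ (periodicGroundStateEnergy_le v Ψ)
  simpa using hE

/-- **Large coupling**: for `|t| ≥ max(ρa,|p|²)/C` the inner inequality follows from the
trivial floor `t⟨∑cos⟩ ≥ −|t|N` and `E₀ ≤ E_Ψ`. [folklore] -/
theorem ineq_of_large_t (v : ℝ → ℝ≥0∞) {C : ℝ} (hC : 0 < C) (ρ : ℝ) {N : ℕ} (k : Fin 3 → ℤ)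
    {t : ℝ} (Ψ : PeriodicTrialState N (sideLength ρ N)) (hΨ : periodicEnergy v Ψ ≠ ⊤)
    (hM : 0 < max (ρ * (scatteringLength v).toReal) (psq (sideLength ρ N) k))
    (ht : max (ρ * (scatteringLength v).toReal) (psq (sideLength ρ N) k) / C ≤ |t|) :
    Ineq v C ρ N k t Ψ := by
  unfold Ineq
  set M := max (ρ * (scatteringLength v).toReal) (psq (sideLength ρ N) k) with hMdef
  set X := cosMean (sideLength ρ N) k Ψ
  have hE := ENNReal.toReal_mono hΨ (periodicGroundStateEnergy_le v Ψ)
  have hX : |X| ≤ N := abs_cosMean_le k Ψ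
  have hN : (0 : ℝ) ≤ N := by positivity
  have htX : -(|t| * N) ≤ t * X := by
    have h1 := neg_abs_le (t * X)
    rw [abs_mul] at h1
    nlinarith [abs_nonneg t, abs_nonneg X]
  have h1 : M ≤ C * |t| := by rwa [div_le_iff₀' hC] at ht
  have h2 : |t| * N ≤ C * t ^ 2 * N / M := by
    rw [le_div_iff₀ hM, ← sq_abs t]
    have := mul_le_mul_of_nonneg_left h1 (mul_nonneg (abs_nonneg t) hN)
    nlinarith
  linarith

end

end Summit.AtomisticToContinuum.BoseEinsteinCondensation.Theorems.StaticResponseBound.Negative
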